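import Summits.QuantumFields.YangMills.Theorems.VirialFluxGapFixGenericParameters
import Summits.QuantumFields.YangMills.Theorems.VirialFluxGapGradientEnergyBoundL4
import HarnessLib

/-!
# Route `VirialFluxGap` (YangMills): the RESOLVENT EULER FIELD on `X_fix` — the FLOOR of the shifted Hessian on the generic window,
# exported, with its corollaries (invertibility, signed drive, size of the resolvent vector) — inputs of the PATCHING step

Toward the deciding crux `VirialFluxGap.PeriodicSoftness` (item stmt-QuantumFields-24141), resolvent Euler field (memo
`fcl-p3-g40-RESOLVENT-EULER-FIELD-24141-v3.md`).  The patching of the generic field `2X_g = (H + λ⋆1)⁻¹g` with the central charts needs, at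
every window-regular point, three facts that ✓`generic_drive_lower` derives INTERNALLY but does not export: the quadratic FLOOR
`vᵀ(H + λ⋆1)v ≥ (λ⋆/2)|v|²` (from ✓`floor_of_drift` at the comb zero of ✓`exists_fixChart_of_regular`), hence `det(H + λ⋆1)` is a unit (so
✓`sum_frameD_resolventCoeff` applies and a smooth det-localiser can be inserted), the drive `gᵀA⁻¹g ≥ 0` (positivity clause of w2's
✓`periodicSoftness_of_smoothFrameField_cutoff`), and the SIZE `|(A⁻¹g)_j|² ≤ |g|²/(λ⋆/2)² ≤ 2·C₂L⁴·#ι·F₀/(λ⋆/2)²` (w3's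
✓`exists_frameD_sq_le_L4_ringDeficit`) which makes the cut-off cross term `Σ_j ∂_jχ_reg·(A⁻¹g)_j` small on the window.

* §1 `generic_floor` — frame-agnostic: the floor under the data of ✓`generic_drive_lower` (zero `p = P·exp(Y_u)`, `K`, smallness);
* §2 `fix_generic_floor` ∕ `fix_generic_floor_eps` ∕ ★★ `fix_generic_floor_window` — on `X_fix` in w2's frame `fixFrameStd`, the last one under
  the SAME hypotheses as ✓`fix_generic_drive_lower_window` (`λ⋆ = εκ/3`, `κ = ρ²/(1032960L⁸)`, threshold `t₀`);
* §3 corollaries under the window: `fix_generic_isUnit_det_window`, `fix_generic_drive_nonneg_window` (`0 ≤ gᵀA⁻¹g`),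
  `fix_generic_resolvent_sq_le_window` (`(λ⋆/2)²·|A⁻¹g|² ≤ |g|²`), `frameGrad_dot_self_le` (`|g|² ≤ #ι·2C₂L⁴·F₀` given the gradient–energy
  constant), `fix_generic_resolvent_entry_sq_le_window` (`(λ⋆/2)²·(A⁻¹g)_j² ≤ #ι·2C₂L⁴·F₀`).

HONEST LABEL: pointwise helpers, generic region only; the cut-offs, the central charts (w3) and the patching/assembly are NOT here; the Euler
field is NOT assembled; ⟨24141⟩, ⟨22884⟩ remain OPEN; the Yang–Mills mass gap is NOT proved; no summit is proved by a line.  THEOREMS ONLY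
(0 `def`, 0 `sorry`), standard axioms.  Explicit-unit seat `ym-line-fcl-p3` g41 (cell ym-idea-1, free hands), `--supports stmt-QuantumFields-24141`.
References: [cite: Luscher1983, §2]; [folklore].
-/

set_option autoImplicit false

noncomputable section

open scoped Matrix BigOperators ContDiff Topology Quaternion
open MeasureTheory Set Matrix
open Literature.MathematicalPhysics.QuantumFieldTheory hiding SU2
open Literature.MathematicalPhysics.QuantumLattice
open Literature.MathematicalPhysics.QuantumFieldTheory.SUNBakryEmery (expSU coe_expSU matTop)

namespace Summit.QuantumFields.YangMills.Theorems.VirialFluxGap.FrameHessian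

open Summit.QuantumFields.YangMills.Theorems.FemtoTransferGap
open Summit.QuantumFields.YangMills.Theorems.FemtoTransferGap.TT
open Summit.QuantumFields.YangMills.Theorems.FemtoTransferGap.TwoLattice
open Summit.QuantumFields.YangMills.Theorems.FemtoTransferGap.TwoLattice.Flat
open Summit.QuantumFields.YangMills.Theorems.VirialFluxGap.RingDeficit
open Summit.QuantumFields.YangMills.Theorems.VirialFluxGap.FrameDerivative
open Summit.QuantumFields.YangMills.Theorems.VirialFluxGap.ResolventField
open Summit.QuantumFields.YangMills.Theorems.VirialFluxGap.RegularValley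
open Summit.QuantumFields.YangMills.Theorems.VirialFluxGap.FixFrame

variable {L : ℕ} [NeZero L]
variable {ι : Type*} [Fintype ι]

open scoped Matrix.Norms.Frobenius


/-! ## §1 The floor, frame-agnostic -/

/-- ★ **The quadratic floor of the shifted frame Hessian** (frame-agnostic).  For skew-Hermitian traceless assignments `τ_j` with slot norms
`≤ 1`, a coordinate vector `u` whose translate `P·exp(Y_u)` is a zero of the deficit, a trilinear third-derivative constant `K` and the smallness
`K·(Σ|u_j|)·#ι ≤ λ⋆/2`: `(λ⋆/2)·|v|² ≤ vᵀ(H(P) + λ⋆1)v` for every `v` — the drift of the Hessian from the (positive-semidefinite) Hessian at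
the zero is `≤ K·Σ|u_j|` entrywise (✓`pointwise_taylor_package`), then ✓`floor_of_drift`. [folklore] -/
theorem generic_floor {τ : ι → ((Fin (2 * L - 1 + 1) × Edge 3 L) ⊕ Site 3 L) → Matrix (Fin 2) (Fin 2) ℂ} (hτ : ∀ j w, (τ j w)ᴴ = -τ j w)
    (hτ0 : ∀ j w, (τ j w).trace = 0) (hτn : ∀ j w, ‖τ j w‖ ≤ 1) [DecidableEq ι] (u : ι → ℝ)
    (P : ((Fin (2 * L - 1 + 1) → GaugeConfig 3 L SU2) × (Site 3 L → SU2)))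
    (hp : ringDeficit L (fun _ => false) (P * multiCurve (dirOf τ u) (dirOf_conjTranspose hτ u) (dirOf_trace hτ0 u) 1) = 0)
    {K lam : ℝ} (hK : 0 ≤ K)
    (hK3 : ∀ (Y₁ Y₂ Y₃ : ((Fin (2 * L - 1 + 1) × Edge 3 L) ⊕ Site 3 L) → Matrix (Fin 2) (Fin 2) ℂ) (b₁ b₂ b₃ : ℝ), 0 ≤ b₁ → 0 ≤ b₂ → 0 ≤ b₃ →
      (∀ w, ‖Y₁ w‖ ≤ b₁) → (∀ w, ‖Y₂ w‖ ≤ b₂) → (∀ w, ‖Y₃ w‖ ≤ b₃) → ∀ Q : ((Fin (2 * L - 1 + 1) → GaugeConfig 3 L SU2) × (Site 3 L → SU2)),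
      |frameD Y₁ (frameD Y₂ (frameD Y₃ (ringPoly L))) (ringCoord L Q)| ≤ K * b₁ * b₂ * b₃)
    (hsmall : K * (∑ j, |u j|) * Fintype.card ι ≤ lam / 2) (v : ι → ℝ) :
    (lam / 2) * (v ⬝ᵥ v) ≤ v ⬝ᵥ ((frameHess (L := L) τ (ringCoord L P) + lam • (1 : Matrix ι ι ℝ)) *ᵥ v) := by
  classical
  set ℓ := ∑ j, |u j| with hℓ
  have hℓ0 : 0 ≤ ℓ := Finset.sum_nonneg fun j _ => abs_nonneg _
  have hYu : ∀ w, ‖dirOf τ u w‖ ≤ ℓ := fun w => norm_dirOf_le hτn u w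
  have hK1 : ∀ j k (Q : ((Fin (2 * L - 1 + 1) → GaugeConfig 3 L SU2) × (Site 3 L → SU2))),
      |frameD (dirOf τ u) (frameD (τ j) (frameD (τ k) (ringPoly L))) (ringCoord L Q)| ≤ K * ℓ := by
    intro j k Q
    have h := hK3 (dirOf τ u) (τ j) (τ k) ℓ 1 1 hℓ0 zero_le_one zero_le_one hYu (hτn j) (hτn k) Q
    simpa using h
  have hK2 : ∀ k (Q : ((Fin (2 * L - 1 + 1) → GaugeConfig 3 L SU2) × (Site 3 L → SU2))),
      |frameD (dirOf τ u) (frameD (dirOf τ u) (frameD (τ k) (ringPoly L))) (ringCoord L Q)| ≤ K * ℓ ^ 2 := by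
    intro k Q
    have h := hK3 (dirOf τ u) (dirOf τ u) (τ k) ℓ ℓ 1 hℓ0 hℓ0 zero_le_one hYu hYu (hτn k) Q
    calc _ ≤ K * ℓ * ℓ * 1 := h
      _ = K * ℓ ^ 2 := by ring
  have hK3' : ∀ Q : ((Fin (2 * L - 1 + 1) → GaugeConfig 3 L SU2) × (Site 3 L → SU2)),
      |frameD (dirOf τ u) (frameD (dirOf τ u) (frameD (dirOf τ u) (ringPoly L))) (ringCoord L Q)| ≤ K * ℓ ^ 3 := by
    intro Q
    have h := hK3 (dirOf τ u) (dirOf τ u) (dirOf τ u) ℓ ℓ ℓ hℓ0 hℓ0 hℓ0 hYu hYu hYu Q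
    calc _ ≤ K * ℓ * ℓ * ℓ := h
      _ = K * ℓ ^ 3 := by ring
  obtain ⟨-, -, ⟨hsymm, hpsd⟩, hc4⟩ := pointwise_taylor_package hτ hτ0 u P hp hK1 hK2 hK3'
  have hKℓ : 0 ≤ K * ℓ := mul_nonneg hK hℓ0
  set p := P * multiCurve (dirOf τ u) (dirOf_conjTranspose hτ u) (dirOf_trace hτ0 u) 1 with hpdef
  have hHp : frameHess (L := L) τ (ringCoord L p) = frameHessRaw (L := L) τ (ringCoord L p) :=
    frameHess_eq_raw_of_symm τ _ hsymm
  have hdrift : ∀ j k, |frameHess (L := L) τ (ringCoord L P) j k - frameHessRaw (L := L) τ (ringCoord L p) j k| ≤ K * ℓ := by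
    intro j k; rw [← hHp]; exact hc4 j k
  have h := floor_of_drift (lam := lam) hKℓ hdrift hpsd v
  have hcard : K * ℓ * Fintype.card ι ≤ lam / 2 := hsmall
  have hvv : 0 ≤ v ⬝ᵥ v := Finset.sum_nonneg fun i _ => mul_self_nonneg (v i)
  nlinarith

/-! ## §2 The floor on `X_fix`, frame `fixFrameStd` -/

/-- ★ **The floor on `X_fix`, generic region.**  At a slice-0 comb-gauged, `ρ`-regular ring history `P` with `224L²√F₀(P) < ρ`, for the frame
family `fixFrameStd`, any trilinear constant `K`, any `λ⋆` and the smallness `K·√(#ι·D)·#ι ≤ λ⋆/2` (`D = 1032960L⁸F₀(P)/ρ²`):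
`(λ⋆/2)|v|² ≤ vᵀ(H + λ⋆1)v`.  Geometric input: w2's ✓`exists_fixChart_of_regular`. [cite: Luscher1983, §2] -/
theorem fix_generic_floor [DecidableEq (FixVar L × Fin 3)] (P : ((Fin (2 * L - 1 + 1) → GaugeConfig 3 L SU2) × (Site 3 L → SU2)))
    (hP : ∀ e : Edge 3 L, treeEdge e = true → P.1 0 e = 1) {ρ : ℝ} (hρ : 0 < ρ)
    (hfar : (∃ k : Fin 3, ρ ^ 2 ≤ 1 - (su2Quat (wrapReps (P.1 0) k)).re ^ 2) ∨ ρ ^ 2 ≤ 1 - (su2Quat (P.2 0)).re ^ 2)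
    (hsmall : 224 * (L : ℝ) ^ 2 * Real.sqrt (ringDeficit L (fun _ => false) P) < ρ)
    {K lam : ℝ} (hK : 0 ≤ K)
    (hK3 : ∀ (Y₁ Y₂ Y₃ : ((Fin (2 * L - 1 + 1) × Edge 3 L) ⊕ Site 3 L) → Matrix (Fin 2) (Fin 2) ℂ) (b₁ b₂ b₃ : ℝ), 0 ≤ b₁ → 0 ≤ b₂ → 0 ≤ b₃ →
      (∀ w, ‖Y₁ w‖ ≤ b₁) → (∀ w, ‖Y₂ w‖ ≤ b₂) → (∀ w, ‖Y₃ w‖ ≤ b₃) → ∀ Q : ((Fin (2 * L - 1 + 1) → GaugeConfig 3 L SU2) × (Site 3 L → SU2)),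
      |frameD Y₁ (frameD Y₂ (frameD Y₃ (ringPoly L))) (ringCoord L Q)| ≤ K * b₁ * b₂ * b₃)
    (hsmall2 : K * Real.sqrt (Fintype.card (FixVar L × Fin 3) * (1032960 * (L : ℝ) ^ 8 * ringDeficit L (fun _ => false) P / ρ ^ 2)) *
      Fintype.card (FixVar L × Fin 3) ≤ lam / 2) (v : FixVar L × Fin 3 → ℝ) :
    (lam / 2) * (v ⬝ᵥ v) ≤ v ⬝ᵥ ((frameHess (L := L) fixFrameStd (ringCoord L P) +
      lam • (1 : Matrix (FixVar L × Fin 3) (FixVar L × Fin 3) ℝ)) *ᵥ v) := by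
  classical
  obtain ⟨n₁, n₂, n₃, th, tc, h', c', u, -, -, -, hp0, hPu, huu⟩ := exists_fixChart_of_regular P hP hρ hfar hsmall
  have hp : ringDeficit L (fun _ => false) (P * multiCurve (dirOf fixFrameStd u) (dirOf_conjTranspose fixFrameStd_conjTranspose u)
      (dirOf_trace fixFrameStd_trace u) 1) = 0 := by rw [hPu]; exact hp0
  have hl1 : ∑ j, |u j| ≤ Real.sqrt (Fintype.card (FixVar L × Fin 3) * (1032960 * (L : ℝ) ^ 8 * ringDeficit L (fun _ => false) P / ρ ^ 2)) :=
    sum_abs_le_sqrt u huu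
  have hc0 : (0 : ℝ) ≤ Fintype.card (FixVar L × Fin 3) := Nat.cast_nonneg _
  have hsm : K * (∑ j, |u j|) * Fintype.card (FixVar L × Fin 3) ≤ lam / 2 :=
    le_trans (mul_le_mul_of_nonneg_right (mul_le_mul_of_nonneg_left hl1 hK) hc0) hsmall2
  exact generic_floor (L := L) (τ := fixFrameStd) fixFrameStd_conjTranspose fixFrameStd_trace norm_fixFrameStd_le u P hp hK hK3 hsm v

/-- ★ **The floor, ε-form** (`λ⋆ = εκ/3`, deficit window `D ≤ ε³κ²/(10⁴(K+1)²#ι⁵)`): `(εκ/6)|v|² ≤ vᵀ(H + (εκ/3)1)v`. [cite: Luscher1983, §2] -/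
theorem fix_generic_floor_eps [DecidableEq (FixVar L × Fin 3)] (P : ((Fin (2 * L - 1 + 1) → GaugeConfig 3 L SU2) × (Site 3 L → SU2)))
    (hP : ∀ e : Edge 3 L, treeEdge e = true → P.1 0 e = 1) {ρ : ℝ} (hρ : 0 < ρ)
    (hfar : (∃ k : Fin 3, ρ ^ 2 ≤ 1 - (su2Quat (wrapReps (P.1 0) k)).re ^ 2) ∨ ρ ^ 2 ≤ 1 - (su2Quat (P.2 0)).re ^ 2)
    (hsmall : 224 * (L : ℝ) ^ 2 * Real.sqrt (ringDeficit L (fun _ => false) P) < ρ)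
    {K ε : ℝ} (hK : 0 ≤ K) (hε : 0 < ε) (hε1 : ε ≤ 1)
    (hK3 : ∀ (Y₁ Y₂ Y₃ : ((Fin (2 * L - 1 + 1) × Edge 3 L) ⊕ Site 3 L) → Matrix (Fin 2) (Fin 2) ℂ) (b₁ b₂ b₃ : ℝ), 0 ≤ b₁ → 0 ≤ b₂ → 0 ≤ b₃ →
      (∀ w, ‖Y₁ w‖ ≤ b₁) → (∀ w, ‖Y₂ w‖ ≤ b₂) → (∀ w, ‖Y₃ w‖ ≤ b₃) → ∀ Q : ((Fin (2 * L - 1 + 1) → GaugeConfig 3 L SU2) × (Site 3 L → SU2)),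
      |frameD Y₁ (frameD Y₂ (frameD Y₃ (ringPoly L))) (ringCoord L Q)| ≤ K * b₁ * b₂ * b₃)
    (hD : 1032960 * (L : ℝ) ^ 8 * ringDeficit L (fun _ => false) P / ρ ^ 2 ≤
      ε ^ 3 * (ρ ^ 2 / (1032960 * (L : ℝ) ^ 8)) ^ 2 / (10000 * (K + 1) ^ 2 * (Fintype.card (FixVar L × Fin 3) : ℝ) ^ 5))
    (v : FixVar L × Fin 3 → ℝ) :
    ((ε * (ρ ^ 2 / (1032960 * (L : ℝ) ^ 8)) / 3) / 2) * (v ⬝ᵥ v) ≤ v ⬝ᵥ ((frameHess (L := L) fixFrameStd (ringCoord L P) +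
      (ε * (ρ ^ 2 / (1032960 * (L : ℝ) ^ 8)) / 3) • (1 : Matrix (FixVar L × Fin 3) (FixVar L × Fin 3) ℝ)) *ᵥ v) := by
  set κ := ρ ^ 2 / (1032960 * (L : ℝ) ^ 8) with hκ
  have hL0 : (0 : ℝ) < L := by exact_mod_cast NeZero.pos L
  have hκ0 : 0 < κ := by rw [hκ]; positivity
  have hF0 : 0 ≤ ringDeficit L (fun _ => false) P := ringDeficit_nonneg _ _
  have hD0 : 0 ≤ 1032960 * (L : ℝ) ^ 8 * ringDeficit L (fun _ => false) P / ρ ^ 2 := by positivity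
  have hsm2 : K * Real.sqrt ((Fintype.card (FixVar L × Fin 3) : ℝ) * (1032960 * (L : ℝ) ^ 8 * ringDeficit L (fun _ => false) P / ρ ^ 2)) *
      (Fintype.card (FixVar L × Fin 3) : ℝ) ≤ (ε * κ / 3) / 2 :=
    param_smallness hε hε1 hK hκ0 card_fixVar_mul_three_ge hD0 hD
  exact fix_generic_floor P hP hρ hfar hsmall hK hK3 hsm2 v

/-- ★★ **The floor under the deficit window** — SAME hypotheses as ✓`fix_generic_drive_lower_window` (`t₀ = ρ²ε³κ²/(1032960·10⁴·L⁸(K+1)²#ι⁵)`):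
`(εκ/6)|v|² ≤ vᵀ(H + (εκ/3)1)v` at every slice-0 comb-gauged `ρ`-regular point with `F₀(P) ≤ t₀`. [cite: Luscher1983, §2] -/
theorem fix_generic_floor_window [DecidableEq (FixVar L × Fin 3)] (P : ((Fin (2 * L - 1 + 1) → GaugeConfig 3 L SU2) × (Site 3 L → SU2)))
    (hP : ∀ e : Edge 3 L, treeEdge e = true → P.1 0 e = 1) {ρ : ℝ} (hρ : 0 < ρ) (hρ1 : ρ ≤ 1)
    (hfar : (∃ k : Fin 3, ρ ^ 2 ≤ 1 - (su2Quat (wrapReps (P.1 0) k)).re ^ 2) ∨ ρ ^ 2 ≤ 1 - (su2Quat (P.2 0)).re ^ 2)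
    {K ε : ℝ} (hK : 0 ≤ K) (hε : 0 < ε) (hε1 : ε ≤ 1)
    (hK3 : ∀ (Y₁ Y₂ Y₃ : ((Fin (2 * L - 1 + 1) × Edge 3 L) ⊕ Site 3 L) → Matrix (Fin 2) (Fin 2) ℂ) (b₁ b₂ b₃ : ℝ), 0 ≤ b₁ → 0 ≤ b₂ → 0 ≤ b₃ →
      (∀ w, ‖Y₁ w‖ ≤ b₁) → (∀ w, ‖Y₂ w‖ ≤ b₂) → (∀ w, ‖Y₃ w‖ ≤ b₃) → ∀ Q : ((Fin (2 * L - 1 + 1) → GaugeConfig 3 L SU2) × (Site 3 L → SU2)),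
      |frameD Y₁ (frameD Y₂ (frameD Y₃ (ringPoly L))) (ringCoord L Q)| ≤ K * b₁ * b₂ * b₃)
    (ht : ringDeficit L (fun _ => false) P ≤ ρ ^ 2 * ε ^ 3 * (ρ ^ 2 / (1032960 * (L : ℝ) ^ 8)) ^ 2 /
      (1032960 * 10000 * (L : ℝ) ^ 8 * (K + 1) ^ 2 * (Fintype.card (FixVar L × Fin 3) : ℝ) ^ 5))
    (v : FixVar L × Fin 3 → ℝ) :
    ((ε * (ρ ^ 2 / (1032960 * (L : ℝ) ^ 8)) / 3) / 2) * (v ⬝ᵥ v) ≤ v ⬝ᵥ ((frameHess (L := L) fixFrameStd (ringCoord L P) +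
      (ε * (ρ ^ 2 / (1032960 * (L : ℝ) ^ 8)) / 3) • (1 : Matrix (FixVar L × Fin 3) (FixVar L × Fin 3) ℝ)) *ᵥ v) := by
  have hL1 : (1 : ℝ) ≤ L := by exact_mod_cast NeZero.one_le
  obtain ⟨hsmall, hD⟩ := param_window hρ hρ1 hε hε1 hK card_fixVar_mul_three_ge hL1 ht
  exact fix_generic_floor_eps P hP hρ hfar hsmall hK hε hε1 hK3 hD v

/-! ## §3 Corollaries under the window: invertibility, signed drive, size of the resolvent vector -/

/-- The window shift `λ⋆ = εκ/3` has `λ⋆/2 > 0`. [folklore] -/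
theorem window_shift_half_pos {ρ ε : ℝ} (hρ : 0 < ρ) (hε : 0 < ε) :
    0 < ((ε * (ρ ^ 2 / (1032960 * (L : ℝ) ^ 8)) / 3) / 2) := by
  have hL0 : (0 : ℝ) < L := by exact_mod_cast NeZero.pos L
  positivity

/-- ★ Under the window, `det(H + λ⋆1)` is a unit (✓`ResolventField.isUnit_det_of_floor`) — so ✓`sum_frameD_resolventCoeff` applies at the point. [folklore] -/
theorem fix_generic_isUnit_det_window [DecidableEq (FixVar L × Fin 3)] (P : ((Fin (2 * L - 1 + 1) → GaugeConfig 3 L SU2) × (Site 3 L → SU2)))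
    (hP : ∀ e : Edge 3 L, treeEdge e = true → P.1 0 e = 1) {ρ : ℝ} (hρ : 0 < ρ) (hρ1 : ρ ≤ 1)
    (hfar : (∃ k : Fin 3, ρ ^ 2 ≤ 1 - (su2Quat (wrapReps (P.1 0) k)).re ^ 2) ∨ ρ ^ 2 ≤ 1 - (su2Quat (P.2 0)).re ^ 2)
    {K ε : ℝ} (hK : 0 ≤ K) (hε : 0 < ε) (hε1 : ε ≤ 1)
    (hK3 : ∀ (Y₁ Y₂ Y₃ : ((Fin (2 * L - 1 + 1) × Edge 3 L) ⊕ Site 3 L) → Matrix (Fin 2) (Fin 2) ℂ) (b₁ b₂ b₃ : ℝ), 0 ≤ b₁ → 0 ≤ b₂ → 0 ≤ b₃ →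
      (∀ w, ‖Y₁ w‖ ≤ b₁) → (∀ w, ‖Y₂ w‖ ≤ b₂) → (∀ w, ‖Y₃ w‖ ≤ b₃) → ∀ Q : ((Fin (2 * L - 1 + 1) → GaugeConfig 3 L SU2) × (Site 3 L → SU2)),
      |frameD Y₁ (frameD Y₂ (frameD Y₃ (ringPoly L))) (ringCoord L Q)| ≤ K * b₁ * b₂ * b₃)
    (ht : ringDeficit L (fun _ => false) P ≤ ρ ^ 2 * ε ^ 3 * (ρ ^ 2 / (1032960 * (L : ℝ) ^ 8)) ^ 2 /
      (1032960 * 10000 * (L : ℝ) ^ 8 * (K + 1) ^ 2 * (Fintype.card (FixVar L × Fin 3) : ℝ) ^ 5)) :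
    IsUnit (frameHess (L := L) fixFrameStd (ringCoord L P) +
      (ε * (ρ ^ 2 / (1032960 * (L : ℝ) ^ 8)) / 3) • (1 : Matrix (FixVar L × Fin 3) (FixVar L × Fin 3) ℝ)).det :=
  isUnit_det_of_floor (window_shift_half_pos (L := L) hρ hε) (fix_generic_floor_window P hP hρ hρ1 hfar hK hε hε1 hK3 ht)

/-- ★ Under the window the drive of the resolvent field is signed: `0 ≤ gᵀ(H + λ⋆1)⁻¹g` (✓`ResolventField.inv_form_nonneg`) — the positivity
clause of w2's ✓`periodicSoftness_of_smoothFrameField_cutoff` on the generic region. [folklore] -/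
theorem fix_generic_drive_nonneg_window [DecidableEq (FixVar L × Fin 3)] (P : ((Fin (2 * L - 1 + 1) → GaugeConfig 3 L SU2) × (Site 3 L → SU2)))
    (hP : ∀ e : Edge 3 L, treeEdge e = true → P.1 0 e = 1) {ρ : ℝ} (hρ : 0 < ρ) (hρ1 : ρ ≤ 1)
    (hfar : (∃ k : Fin 3, ρ ^ 2 ≤ 1 - (su2Quat (wrapReps (P.1 0) k)).re ^ 2) ∨ ρ ^ 2 ≤ 1 - (su2Quat (P.2 0)).re ^ 2)
    {K ε : ℝ} (hK : 0 ≤ K) (hε : 0 < ε) (hε1 : ε ≤ 1)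
    (hK3 : ∀ (Y₁ Y₂ Y₃ : ((Fin (2 * L - 1 + 1) × Edge 3 L) ⊕ Site 3 L) → Matrix (Fin 2) (Fin 2) ℂ) (b₁ b₂ b₃ : ℝ), 0 ≤ b₁ → 0 ≤ b₂ → 0 ≤ b₃ →
      (∀ w, ‖Y₁ w‖ ≤ b₁) → (∀ w, ‖Y₂ w‖ ≤ b₂) → (∀ w, ‖Y₃ w‖ ≤ b₃) → ∀ Q : ((Fin (2 * L - 1 + 1) → GaugeConfig 3 L SU2) × (Site 3 L → SU2)),
      |frameD Y₁ (frameD Y₂ (frameD Y₃ (ringPoly L))) (ringCoord L Q)| ≤ K * b₁ * b₂ * b₃)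
    (ht : ringDeficit L (fun _ => false) P ≤ ρ ^ 2 * ε ^ 3 * (ρ ^ 2 / (1032960 * (L : ℝ) ^ 8)) ^ 2 /
      (1032960 * 10000 * (L : ℝ) ^ 8 * (K + 1) ^ 2 * (Fintype.card (FixVar L × Fin 3) : ℝ) ^ 5)) :
    0 ≤ frameGrad (L := L) fixFrameStd (ringCoord L P) ⬝ᵥ
      ((frameHess (L := L) fixFrameStd (ringCoord L P) +
        (ε * (ρ ^ 2 / (1032960 * (L : ℝ) ^ 8)) / 3) • (1 : Matrix (FixVar L × Fin 3) (FixVar L × Fin 3) ℝ))⁻¹ *ᵥ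
        frameGrad (L := L) fixFrameStd (ringCoord L P)) :=
  inv_form_nonneg (window_shift_half_pos (L := L) hρ hε) (fix_generic_floor_window P hP hρ hρ1 hfar hK hε hε1 hK3 ht) _

/-- ★ Under the window the resolvent vector is controlled by the gradient: `(λ⋆/2)²·|A⁻¹g|² ≤ |g|²` (✓`ResolventField.inv_mulVec_sq_le`). [folklore] -/
theorem fix_generic_resolvent_sq_le_window [DecidableEq (FixVar L × Fin 3)] (P : ((Fin (2 * L - 1 + 1) → GaugeConfig 3 L SU2) × (Site 3 L → SU2)))
    (hP : ∀ e : Edge 3 L, treeEdge e = true → P.1 0 e = 1) {ρ : ℝ} (hρ : 0 < ρ) (hρ1 : ρ ≤ 1)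
    (hfar : (∃ k : Fin 3, ρ ^ 2 ≤ 1 - (su2Quat (wrapReps (P.1 0) k)).re ^ 2) ∨ ρ ^ 2 ≤ 1 - (su2Quat (P.2 0)).re ^ 2)
    {K ε : ℝ} (hK : 0 ≤ K) (hε : 0 < ε) (hε1 : ε ≤ 1)
    (hK3 : ∀ (Y₁ Y₂ Y₃ : ((Fin (2 * L - 1 + 1) × Edge 3 L) ⊕ Site 3 L) → Matrix (Fin 2) (Fin 2) ℂ) (b₁ b₂ b₃ : ℝ), 0 ≤ b₁ → 0 ≤ b₂ → 0 ≤ b₃ →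
      (∀ w, ‖Y₁ w‖ ≤ b₁) → (∀ w, ‖Y₂ w‖ ≤ b₂) → (∀ w, ‖Y₃ w‖ ≤ b₃) → ∀ Q : ((Fin (2 * L - 1 + 1) → GaugeConfig 3 L SU2) × (Site 3 L → SU2)),
      |frameD Y₁ (frameD Y₂ (frameD Y₃ (ringPoly L))) (ringCoord L Q)| ≤ K * b₁ * b₂ * b₃)
    (ht : ringDeficit L (fun _ => false) P ≤ ρ ^ 2 * ε ^ 3 * (ρ ^ 2 / (1032960 * (L : ℝ) ^ 8)) ^ 2 /
      (1032960 * 10000 * (L : ℝ) ^ 8 * (K + 1) ^ 2 * (Fintype.card (FixVar L × Fin 3) : ℝ) ^ 5)) :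
    ((ε * (ρ ^ 2 / (1032960 * (L : ℝ) ^ 8)) / 3) / 2) ^ 2 *
        ((((frameHess (L := L) fixFrameStd (ringCoord L P) +
            (ε * (ρ ^ 2 / (1032960 * (L : ℝ) ^ 8)) / 3) • (1 : Matrix (FixVar L × Fin 3) (FixVar L × Fin 3) ℝ))⁻¹ *ᵥ
            frameGrad (L := L) fixFrameStd (ringCoord L P)) ⬝ᵥ
          ((frameHess (L := L) fixFrameStd (ringCoord L P) +
            (ε * (ρ ^ 2 / (1032960 * (L : ℝ) ^ 8)) / 3) • (1 : Matrix (FixVar L × Fin 3) (FixVar L × Fin 3) ℝ))⁻¹ *ᵥ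
            frameGrad (L := L) fixFrameStd (ringCoord L P)))) ≤
      frameGrad (L := L) fixFrameStd (ringCoord L P) ⬝ᵥ frameGrad (L := L) fixFrameStd (ringCoord L P) :=
  inv_mulVec_sq_le (window_shift_half_pos (L := L) hρ hε) (fix_generic_floor_window P hP hρ hρ1 hfar hK hε hε1 hK3 ht) _

/-- The squared frame gradient in the family `fixFrameStd` is controlled by the energy: given a gradient–energy constant `C₂` in the shape of
w3's ✓`exists_frameD_sq_le_L4_ringDeficit` (`(∂_Y F₀)² ≤ 2·C₂L⁴b²·F₀` for slot norms `≤ b`), `|g|² ≤ #ι·(2·C₂L⁴)·F₀(P)`. [folklore] -/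
theorem frameGrad_dot_self_le (P : ((Fin (2 * L - 1 + 1) → GaugeConfig 3 L SU2) × (Site 3 L → SU2))) {C₂ : ℝ}
    (hC₂ : ∀ (Q : ((Fin (2 * L - 1 + 1) → GaugeConfig 3 L SU2) × (Site 3 L → SU2)))
      (Y : ((Fin (2 * L - 1 + 1) × Edge 3 L) ⊕ Site 3 L) → Matrix (Fin 2) (Fin 2) ℂ), (∀ w, (Y w)ᴴ = -Y w) → (∀ w, (Y w).trace = 0) →
      ∀ b : ℝ, 0 ≤ b → (∀ w, ‖Y w‖ ≤ b) →
      (frameD Y (ringPoly L) (ringCoord L Q)) ^ 2 ≤ 2 * (C₂ * (L : ℝ) ^ 4 * b ^ 2) * ringDeficit L (fun _ => false) Q) :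
    frameGrad (L := L) fixFrameStd (ringCoord L P) ⬝ᵥ frameGrad (L := L) fixFrameStd (ringCoord L P) ≤
      (Fintype.card (FixVar L × Fin 3) : ℝ) * (2 * (C₂ * (L : ℝ) ^ 4)) * ringDeficit L (fun _ => false) P := by
  have hj : ∀ j : FixVar L × Fin 3, frameGrad (L := L) fixFrameStd (ringCoord L P) j * frameGrad (L := L) fixFrameStd (ringCoord L P) j ≤
      2 * (C₂ * (L : ℝ) ^ 4) * ringDeficit L (fun _ => false) P := by
    intro j
    have h := hC₂ P (fixFrameStd j) (fixFrameStd_conjTranspose j) (fixFrameStd_trace j) 1 zero_le_one (norm_fixFrameStd_le j)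
    rw [← sq]
    simpa [frameGrad] using h
  calc frameGrad (L := L) fixFrameStd (ringCoord L P) ⬝ᵥ frameGrad (L := L) fixFrameStd (ringCoord L P)
      = ∑ j, frameGrad (L := L) fixFrameStd (ringCoord L P) j * frameGrad (L := L) fixFrameStd (ringCoord L P) j := rfl
    _ ≤ ∑ _j : FixVar L × Fin 3, 2 * (C₂ * (L : ℝ) ^ 4) * ringDeficit L (fun _ => false) P := Finset.sum_le_sum fun j _ => hj j
    _ = (Fintype.card (FixVar L × Fin 3) : ℝ) * (2 * (C₂ * (L : ℝ) ^ 4)) * ringDeficit L (fun _ => false) P := by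
        simp [Finset.sum_const, Finset.card_univ, mul_assoc]

/-- ★★ **Size of the resolvent vector under the window**: every entry satisfies `(λ⋆/2)²·((H + λ⋆1)⁻¹g)_j² ≤ #ι·2C₂L⁴·F₀(P)` — so
`|(A⁻¹g)_j| = O(√F₀·L⁴/(εκ))`, polynomially small on the deficit window; this bounds the cut-off cross term `Σ_j ∂_jχ_reg·(A⁻¹g)_j` of the
patching. [folklore] -/
theorem fix_generic_resolvent_entry_sq_le_window [DecidableEq (FixVar L × Fin 3)] (P : ((Fin (2 * L - 1 + 1) → GaugeConfig 3 L SU2) × (Site 3 L → SU2)))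
    (hP : ∀ e : Edge 3 L, treeEdge e = true → P.1 0 e = 1) {ρ : ℝ} (hρ : 0 < ρ) (hρ1 : ρ ≤ 1)
    (hfar : (∃ k : Fin 3, ρ ^ 2 ≤ 1 - (su2Quat (wrapReps (P.1 0) k)).re ^ 2) ∨ ρ ^ 2 ≤ 1 - (su2Quat (P.2 0)).re ^ 2)
    {K ε : ℝ} (hK : 0 ≤ K) (hε : 0 < ε) (hε1 : ε ≤ 1)
    (hK3 : ∀ (Y₁ Y₂ Y₃ : ((Fin (2 * L - 1 + 1) × Edge 3 L) ⊕ Site 3 L) → Matrix (Fin 2) (Fin 2) ℂ) (b₁ b₂ b₃ : ℝ), 0 ≤ b₁ → 0 ≤ b₂ → 0 ≤ b₃ →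
      (∀ w, ‖Y₁ w‖ ≤ b₁) → (∀ w, ‖Y₂ w‖ ≤ b₂) → (∀ w, ‖Y₃ w‖ ≤ b₃) → ∀ Q : ((Fin (2 * L - 1 + 1) → GaugeConfig 3 L SU2) × (Site 3 L → SU2)),
      |frameD Y₁ (frameD Y₂ (frameD Y₃ (ringPoly L))) (ringCoord L Q)| ≤ K * b₁ * b₂ * b₃)
    (ht : ringDeficit L (fun _ => false) P ≤ ρ ^ 2 * ε ^ 3 * (ρ ^ 2 / (1032960 * (L : ℝ) ^ 8)) ^ 2 /
      (1032960 * 10000 * (L : ℝ) ^ 8 * (K + 1) ^ 2 * (Fintype.card (FixVar L × Fin 3) : ℝ) ^ 5))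
    {C₂ : ℝ}
    (hC₂ : ∀ (Q : ((Fin (2 * L - 1 + 1) → GaugeConfig 3 L SU2) × (Site 3 L → SU2)))
      (Y : ((Fin (2 * L - 1 + 1) × Edge 3 L) ⊕ Site 3 L) → Matrix (Fin 2) (Fin 2) ℂ), (∀ w, (Y w)ᴴ = -Y w) → (∀ w, (Y w).trace = 0) →
      ∀ b : ℝ, 0 ≤ b → (∀ w, ‖Y w‖ ≤ b) →
      (frameD Y (ringPoly L) (ringCoord L Q)) ^ 2 ≤ 2 * (C₂ * (L : ℝ) ^ 4 * b ^ 2) * ringDeficit L (fun _ => false) Q)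
    (j : FixVar L × Fin 3) :
    ((ε * (ρ ^ 2 / (1032960 * (L : ℝ) ^ 8)) / 3) / 2) ^ 2 *
        (((frameHess (L := L) fixFrameStd (ringCoord L P) +
            (ε * (ρ ^ 2 / (1032960 * (L : ℝ) ^ 8)) / 3) • (1 : Matrix (FixVar L × Fin 3) (FixVar L × Fin 3) ℝ))⁻¹ *ᵥ
            frameGrad (L := L) fixFrameStd (ringCoord L P)) j) ^ 2 ≤
      (Fintype.card (FixVar L × Fin 3) : ℝ) * (2 * (C₂ * (L : ℝ) ^ 4)) * ringDeficit L (fun _ => false) P := by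
  have h1 := fix_generic_resolvent_sq_le_window P hP hρ hρ1 hfar hK hε hε1 hK3 ht
  have h2 := frameGrad_dot_self_le (L := L) P hC₂
  have h3 := sq_apply_le_dotProduct ((frameHess (L := L) fixFrameStd (ringCoord L P) +
            (ε * (ρ ^ 2 / (1032960 * (L : ℝ) ^ 8)) / 3) • (1 : Matrix (FixVar L × Fin 3) (FixVar L × Fin 3) ℝ))⁻¹ *ᵥ
            frameGrad (L := L) fixFrameStd (ringCoord L P)) j
  have h0 : 0 ≤ ((ε * (ρ ^ 2 / (1032960 * (L : ℝ) ^ 8)) / 3) / 2) ^ 2 := sq_nonneg _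
  calc _ ≤ ((ε * (ρ ^ 2 / (1032960 * (L : ℝ) ^ 8)) / 3) / 2) ^ 2 *
        ((((frameHess (L := L) fixFrameStd (ringCoord L P) +
            (ε * (ρ ^ 2 / (1032960 * (L : ℝ) ^ 8)) / 3) • (1 : Matrix (FixVar L × Fin 3) (FixVar L × Fin 3) ℝ))⁻¹ *ᵥ
            frameGrad (L := L) fixFrameStd (ringCoord L P)) ⬝ᵥ
          ((frameHess (L := L) fixFrameStd (ringCoord L P) +
            (ε * (ρ ^ 2 / (1032960 * (L : ℝ) ^ 8)) / 3) • (1 : Matrix (FixVar L × Fin 3) (FixVar L × Fin 3) ℝ))⁻¹ *ᵥ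
            frameGrad (L := L) fixFrameStd (ringCoord L P)))) := mul_le_mul_of_nonneg_left h3 h0
    _ ≤ _ := h1
    _ ≤ _ := h2

end Summit.QuantumFields.YangMills.Theorems.VirialFluxGap.FrameHessian

end
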